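import Summits.QuantumFields.BalabanUV.T4Continuum.Support.GradedWellBlockChart
import Summits.QuantumFields.BalabanUV.T4Continuum.Support.GradedWellPlanting
import Summits.QuantumFields.BalabanUV.T4Continuum.Support.GradedWellScalarCoercive
import Summits.QuantumFields.BalabanUV.T4Continuum.Support.GradedWellUnitRows

/-!
# T⁴ programme, spine node NE2 (U1a), sub-row Δ1 — graded well, crew socket (GW-W1), file 3b of 4:
# THE GRADED MEAN CORRECTION — a scalar with zero UNIT-block means is corrected to zero GRADED means at an energy cost controlled,
# level-free, by the graded rows of its own gradient

NE2 formalisation swarm `b2b-balaban-t4-ne2-formalise-*`, leaf 09 (gen 11), for the owner's socket (GW-W1) (R47 (e)/R48 (c)/R49 (a),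
journal 2026-08-21).  On files 2/3a (`GradedWellPlanting`, `GradedWellBlockChart`), the owner's `GradedSubBlocks.avgS_GradOp_mulVec`
(«`Q_s∂ = ∂_sQ′_s`», [Balaban1984PropagatorsI] (1.55)) and `GradedWellData` BY NAME.

THE STATEMENT (step (E) of the (GW-W1) transfer).  **`exists_meanCorrection`**: for every scalar `f` on the level-`k` torus whose UNIT-block
means vanish (`∀ Z, (Q′_n f)(Z) = 0`) there is `ρ` with the SAME graded means (`Q′_GWn ρ = Q′_GWn f`) and
`‖∂ρ‖² ≤ 2d(m+1)·36^d · ‖Q_GW(∂f)‖²` — so `f − ρ ∈ N(Q′_GW)` and the correction costs only the graded vector rows of `∂f`, with a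
constant depending on `d, m` alone.  WHY IT IS TRUE: `ρ = plantGW (bfac⁻¹•Q′_GWn f)` (file 2) plants the scale-`s_i` means of `f` on layer
`i` exactly, with energy `Σ_rows (n/s_i)²·s_i^d·β₁^{−2d}·|mean|²`; on each layer-`i` unit block the `(n/s_i)^d` sub-block means of `f` sum
to ZERO (the unit mean vanishes; file 3a `sum_chart_meanS_eq_zero`), so the discrete Poincaré inequality on that grid (file 3a
`cube_poincare_zero_sum`, constant `(n/s_i)²/2`) bounds their squares by the squares of nearest-neighbour DIFFERENCES inside the block,
and by (1.55) at scale `s_i` those differences ARE the layer-`i` rows of `Q_GW(∂f)` up to the factor `s_i/n` (`meanS_shift_sub`); the in-block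
pairs are typed rows because both endpoint blocks lie in layer `i` (print's `st`-convention, `rowMin_chartA`); `(n/s_i)² ≤ L^{2i} = w_i²/s_i^d`.

 * §1 `rowMin` (the typed `RowV` datum on the ambient index), **`nsq_QvGW_eq_sum`** (leaf-07-g11's `QvGW_mulVec_apply`) (‖Q_GW X‖² as a layered sum);
 * §2 `meanS_shift_sub` / `norm_sq_meanS_shift_sub` ((1.55) at scale `s_i`), **`block_poincare`**;
 * §3 `rowMin_chartA`, **`layer_means_sq_le`**: `Σ_{layer-i anchors} |Q′_{s_i}f|² ≤ ½·Σ_{layer-i typed rows} |Q_{s_i}(∂f)|²`;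
 * §4 `nsq_rowLift_QsGWn`, `inv_beta_sq_le`, **`exists_meanCorrection`**.

HONEST FRAMING (T4-DAG p. 1).  [folklore] finite lattice calculus at model level (`U = 1`, one layer map on unit blocks, `m` fixed, finite
torus); constants ours; no estimate of print; NE2 (U1a) NOT proved; spine PROVED 0/9 unchanged; NOT [B9] (3.16)/(3.23)–(3.27) as printed;
NOT infinite volume / mass gap / Clay.  HONEST DEPENDENCY: continuum YM on T⁴ ⇐ BetaPertH ∧ nine spine estimates (0/9 proved);
BetaPertH ⇐ (D1) ∧ (D4) ∧ CAP+tail; G-an2-4 gates asym, D1 and NE2/3/4.  ABSOLUTE RULE kept: no `def … : Prop` fact, no cited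
hypothesis, zero `sorry`.
-/

noncomputable section

open scoped BigOperators ComplexConjugate Matrix
open Finset

namespace Summit.QuantumFields.BalabanUV.T4Continuum.GradedWellMeanCorrection

open Literature.MathematicalPhysics.QuantumFieldTheory.Balaban1983to89.B5Prop11Plancherel (Tor fine)
open Literature.MathematicalPhysics.QuantumFieldTheory.Balaban1983to89.B5Prop11Lower (nsq nsq_nonneg)
open Literature.MathematicalPhysics.QuantumFieldTheory.Balaban1983to89.B5Blocks16 (blockOf)
open Literature.MathematicalPhysics.QuantumFieldTheory.Balaban1983to89.B5G183RateUnitTower (lev lev_neZero)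
open Summit.QuantumFields.BalabanUV.T4Continuum
open Summit.QuantumFields.BalabanUV.T4Continuum.ScalarBlockTrialFunction (beta1 beta1_ge)
open Summit.QuantumFields.BalabanUV.T4Continuum.GradedSubBlocks (Anchor Anc InSub site meanS avgS shiftAnc s_pos avgS_GradOp_mulVec)
open Summit.QuantumFields.BalabanUV.T4Continuum.GradedWellData
open Summit.QuantumFields.BalabanUV.T4Continuum.GradedWellSlice (QsGWn sGW_dvd_lev)
open Summit.QuantumFields.BalabanUV.T4Continuum.GradedWellScalarCoercive (sGW_le)
open Summit.QuantumFields.BalabanUV.T4Continuum.GradedWellPlanting (rowLift rowLift_row plantGW bfac bfac_pos unplant QsGWn_mulVec_apply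
  QsGWn_plantGW_unplant nsq_gradT_plantGW_le sum_mul_nsq_rowLift energy_coeff_unplant lev_le_sGW_mul_pow)
open Summit.QuantumFields.BalabanUV.T4Continuum.GradedWellUnitMass (QvGW_mulVec_apply)
open Summit.QuantumFields.BalabanUV.T4Continuum.GradedWellBlockChart (stepR chartA blockOf_chartA chartA_stepR sum_anchors_eq_sum_chart
  cube_poincare_zero_sum sum_chart_meanS_eq_zero)

variable {d : ℕ} (L : ℕ) [NeZero L] (M : Fin d → ℕ) [hM : ∀ μ, NeZero (M μ)] (k m : ℕ) (layer : Tor M → ℕ)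

/-! ## §1 The typed row condition; `‖Q_GW X‖²` as a layered sum -/

/-- the `RowV` datum (print's `st`-convention) on the ambient index `(i, z, ν)`: `min (layer of z's block) (layer of the block of z + s_i e_ν)`;
`(i, z, ν)` is a typed row iff this equals `i`. [cite: Balaban1984PropagatorsII, (2.3) p.224 (shape)] [folklore] -/
def rowMin (i : Fin (m + 1)) (z : Anc (fine (lev L k) M) (sGW L k i)) (ν : Fin d) : ℕ :=
  min (layer (blockOf (lev L k) M z.1)) (layer (blockOf (lev L k) M (shiftAnc (fine (lev L k) M) (sGW L k i) (sGW_dvd L M k i) ν z).1))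

/-- **`‖Q_GW X‖²` AS A LAYERED SUM over the ambient index with the typed row indicator**. [folklore] -/
theorem nsq_QvGW_eq_sum (X : TorK L M k × Fin d → ℂ) :
    nsq (QvGW L M k m layer *ᵥ X)
      = ∑ i : Fin (m + 1), ∑ zν : Anc (fine (lev L k) M) (sGW L k i) × Fin d,
          (if rowMin L M k m layer i zν.1 zν.2 = (i : ℕ) then wGW L k d i ^ 2 * ‖(avgS (fine (lev L k) M) (sGW L k i) *ᵥ X) zν‖ ^ 2 else 0) := by
  have e1 : ∀ q : RowV L M k m layer, ‖(QvGW L M k m layer *ᵥ X) q‖ ^ 2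
      = wGW L k d q.1.1 ^ 2 * ‖(avgS (fine (lev L k) M) (sGW L k q.1.1) *ᵥ X) q.1.2‖ ^ 2 := by
    intro q
    rw [QvGW_mulVec_apply, norm_mul, mul_pow, Complex.norm_real, Real.norm_of_nonneg (wGW_nonneg L k d q.1.1)]
  unfold nsq
  rw [Finset.sum_congr rfl fun q _ => e1 q]
  let P : ((i : Fin (m + 1)) × (Anc (fine (lev L k) M) (sGW L k i) × Fin d)) → Prop := fun q => rowMin L M k m layer q.1 q.2.1 q.2.2 = (q.1 : ℕ)
  let F : ((i : Fin (m + 1)) × (Anc (fine (lev L k) M) (sGW L k i) × Fin d)) → ℝ :=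
    fun q => wGW L k d q.1 ^ 2 * ‖(avgS (fine (lev L k) M) (sGW L k q.1) *ᵥ X) q.2‖ ^ 2
  have key : ∑ q ∈ Finset.univ.filter P, F q = ∑ p : RowV L M k m layer, F p.1 :=
    Finset.sum_subtype (Finset.univ.filter P) (by intro x; simp [P, rowMin]) F
  show ∑ p : RowV L M k m layer, F p.1 = ∑ i, ∑ zν, if P ⟨i, zν⟩ then F ⟨i, zν⟩ else 0
  rw [← key, Finset.sum_filter, Fintype.sum_sigma]

/-! ## §2 (1.55) at scale `s_i` and the per-block Poincaré inequality -/

/-- **(1.55) AT SCALE `s_i`, DIFFERENCE FORM**: `(Q′_{s_i}f)(z + s_i e_ν) − (Q′_{s_i}f)(z) = (s_i/n)·(Q_{s_i}(∂f))(z, ν)`.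
[cite: Balaban1984PropagatorsI, (1.55) p.27] [folklore] -/
theorem meanS_shift_sub (f : TorK L M k → ℂ) (i : Fin (m + 1)) (z : Anc (fine (lev L k) M) (sGW L k i)) (ν : Fin d) :
    (meanS (fine (lev L k) M) (sGW L k i) *ᵥ f) (shiftAnc (fine (lev L k) M) (sGW L k i) (sGW_dvd L M k i) ν z)
        - (meanS (fine (lev L k) M) (sGW L k i) *ᵥ f) z
      = ((sGW L k i : ℕ) : ℂ) * (((lev L k : ℕ) : ℂ))⁻¹ * (avgS (fine (lev L k) M) (sGW L k i) *ᵥ (gradT L M k *ᵥ f)) (z, ν) := by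
  have hn : ((lev L k : ℕ) : ℂ) ≠ 0 := by exact_mod_cast NeZero.ne (lev L k)
  have hs : ((sGW L k i : ℕ) : ℂ) ≠ 0 := by exact_mod_cast NeZero.ne (sGW L k i)
  rw [avgS_GradOp_mulVec (fine (lev L k) M) (sGW L k i) (sGW_dvd L M k i)]
  field_simp

/-- … in squared norms: `|ΔQ′_{s_i}f|² = (s_i/n)²·|Q_{s_i}(∂f)|²`. [folklore] -/
theorem norm_sq_meanS_shift_sub (f : TorK L M k → ℂ) (i : Fin (m + 1)) (z : Anc (fine (lev L k) M) (sGW L k i)) (ν : Fin d) :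
    ‖(meanS (fine (lev L k) M) (sGW L k i) *ᵥ f) (shiftAnc (fine (lev L k) M) (sGW L k i) (sGW_dvd L M k i) ν z)
        - (meanS (fine (lev L k) M) (sGW L k i) *ᵥ f) z‖ ^ 2
      = (((sGW L k i : ℕ) : ℝ) / ((lev L k : ℕ) : ℝ)) ^ 2 * ‖(avgS (fine (lev L k) M) (sGW L k i) *ᵥ (gradT L M k *ᵥ f)) (z, ν)‖ ^ 2 := by
  rw [meanS_shift_sub, norm_mul, norm_mul, mul_pow, mul_pow, Complex.norm_natCast, norm_inv, Complex.norm_natCast, div_eq_mul_inv, mul_pow]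

omit hM in
/-- the grid side is positive: `0 < n/s_i`. [folklore] -/
theorem div_pos_grid (i : ℕ) : 0 < lev L k / sGW L k i :=
  Nat.div_pos (sGW_le L k i) (s_pos (sGW L k i))

/-- **THE PER-BLOCK POINCARÉ INEQUALITY**: if the unit mean of `f` over the block `Z` vanishes, then
`Σ_o |(Q′_{s_i}f)(Z + s_i o)|² ≤ ((n/s_i)²/2)·Σ_μ Σ_{o : o_μ+1 < n/s_i} |(Q′_{s_i}f)(Z + s_i o + s_i e_μ) − (Q′_{s_i}f)(Z + s_i o)|²`. [folklore] -/
theorem block_poincare (f : TorK L M k → ℂ) (i : ℕ) (Z : Anc (fine (lev L k) M) (lev L k))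
    (h0 : (meanS (fine (lev L k) M) (lev L k) *ᵥ f) Z = 0) :
    ∑ o : Fin d → Fin (lev L k / sGW L k i), ‖(meanS (fine (lev L k) M) (sGW L k i) *ᵥ f) (chartA L M k i Z o)‖ ^ 2
      ≤ ((lev L k / sGW L k i : ℕ) : ℝ) ^ 2 / 2 * ∑ μ : Fin d,
          ∑ o ∈ univ.filter (fun o : Fin d → Fin (lev L k / sGW L k i) => (o μ : ℕ) + 1 < lev L k / sGW L k i),
            ‖(meanS (fine (lev L k) M) (sGW L k i) *ᵥ f) (shiftAnc (fine (lev L k) M) (sGW L k i) (sGW_dvd L M k i) μ (chartA L M k i Z o))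
              - (meanS (fine (lev L k) M) (sGW L k i) *ᵥ f) (chartA L M k i Z o)‖ ^ 2 := by
  have h := cube_poincare_zero_sum (div_pos_grid L k i) (fun o => (meanS (fine (lev L k) M) (sGW L k i) *ᵥ f) (chartA L M k i Z o))
    (sum_chart_meanS_eq_zero L M k i f Z h0)
  refine h.trans (le_of_eq ?_)
  congr 1
  refine Finset.sum_congr rfl fun μ _ => Finset.sum_congr rfl fun o ho => ?_
  rw [Finset.mem_filter] at ho
  rw [chartA_stepR L M k i Z o μ ho.2]

/-! ## §3 The layer-`i` squares of the means are controlled by the layer-`i` typed rows of the gradient -/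

/-- **IN-BLOCK GRID PAIRS ARE TYPED ROWS**: on a layer-`i` unit block `Z`, the pair `(Z + s_i o, Z + s_i o + s_i e_μ)` with `o_μ + 1 < n/s_i` has
both endpoint blocks equal to `Z`'s, so `min = i` (print's `st`-convention). [cite: Balaban1984PropagatorsII, (2.3) p.224 (shape)] [folklore] -/
theorem rowMin_chartA (i : Fin (m + 1)) (Z : Anc (fine (lev L k) M) (lev L k)) (hZ : layer (blockOf (lev L k) M Z.1) = (i : ℕ))
    (o : Fin d → Fin (lev L k / sGW L k i)) (μ : Fin d) (h : (o μ : ℕ) + 1 < lev L k / sGW L k i) :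
    rowMin L M k m layer i (chartA L M k i Z o) μ = (i : ℕ) := by
  rw [rowMin, ← chartA_stepR L M k i Z o μ h, blockOf_chartA, blockOf_chartA, hZ, min_self]

/-- **THE LAYER-`i` MEANS ARE CONTROLLED BY THE LAYER-`i` ROWS OF THE GRADIENT**: if every unit mean of `f` vanishes, then
`Σ_{z : layer-i anchors} |(Q′_{s_i}f)(z)|² ≤ ½·Σ_{(z,ν) : typed layer-i rows} |(Q_{s_i}(∂f))(z,ν)|²` (per block: the grid Poincaré inequality with
constant `(n/s_i)²/2`, times `(s_i/n)²` from (1.55)). [folklore] -/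
theorem layer_means_sq_le (f : TorK L M k → ℂ) (h0 : ∀ Z : Anc (fine (lev L k) M) (lev L k), (meanS (fine (lev L k) M) (lev L k) *ᵥ f) Z = 0)
    (i : Fin (m + 1)) :
    ∑ z : Anc (fine (lev L k) M) (sGW L k i),
        (if layer (blockOf (lev L k) M z.1) = (i : ℕ) then ‖(meanS (fine (lev L k) M) (sGW L k i) *ᵥ f) z‖ ^ 2 else 0)
      ≤ 1 / 2 * ∑ zν : Anc (fine (lev L k) M) (sGW L k i) × Fin d,
          (if rowMin L M k m layer i zν.1 zν.2 = (i : ℕ) then ‖(avgS (fine (lev L k) M) (sGW L k i) *ᵥ (gradT L M k *ᵥ f)) zν‖ ^ 2 else 0) := by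
  set N := fine (lev L k) M with hN
  set t := sGW L k i with ht
  set R := lev L k / sGW L k i with hR
  have hn0 : (0 : ℝ) < ((lev L k : ℕ) : ℝ) := by exact_mod_cast Nat.pos_of_ne_zero (NeZero.ne (lev L k))
  have hRt : ((R : ℕ) : ℝ) * ((t : ℕ) : ℝ) = ((lev L k : ℕ) : ℝ) := by
    rw [hR, ht]; exact_mod_cast Nat.div_mul_cancel (sGW_dvd_lev L k i)
  have hfac : ((R : ℕ) : ℝ) ^ 2 / 2 * ((((t : ℕ) : ℝ) / ((lev L k : ℕ) : ℝ)) ^ 2) = 1 / 2 := by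
    rw [div_pow, ← hRt]
    have ht0 : (0 : ℝ) < ((t : ℕ) : ℝ) := by exact_mod_cast s_pos (sGW L k i)
    have hR0 : (0 : ℝ) < ((R : ℕ) : ℝ) := by exact_mod_cast div_pos_grid L k i
    field_simp
  -- the right-hand side re-indexed by (block, grid point), direction by direction
  have rhs : ∑ zν : Anc N t × Fin d, (if rowMin L M k m layer i zν.1 zν.2 = (i : ℕ) then ‖(avgS N t *ᵥ (gradT L M k *ᵥ f)) zν‖ ^ 2 else 0)
      = ∑ Z : Anc N (lev L k), ∑ μ : Fin d, ∑ o : Fin d → Fin R,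
          (if rowMin L M k m layer i (chartA L M k i Z o) μ = (i : ℕ) then ‖(avgS N t *ᵥ (gradT L M k *ᵥ f)) (chartA L M k i Z o, μ)‖ ^ 2 else 0) := by
    rw [Fintype.sum_prod_type, sum_anchors_eq_sum_chart L M k i]
    refine Finset.sum_congr rfl fun Z _ => ?_
    rw [Finset.sum_comm]
  -- the left-hand side re-indexed
  have lhs : ∑ z : Anc N t, (if layer (blockOf (lev L k) M z.1) = (i : ℕ) then ‖(meanS N t *ᵥ f) z‖ ^ 2 else 0)
      = ∑ Z : Anc N (lev L k), (if layer (blockOf (lev L k) M Z.1) = (i : ℕ) then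
          ∑ o : Fin d → Fin R, ‖(meanS N t *ᵥ f) (chartA L M k i Z o)‖ ^ 2 else 0) := by
    rw [sum_anchors_eq_sum_chart L M k i]
    refine Finset.sum_congr rfl fun Z _ => ?_
    simp_rw [blockOf_chartA]
    split_ifs
    · rfl
    · simp
  rw [lhs, rhs, Finset.mul_sum]
  refine Finset.sum_le_sum fun Z _ => ?_
  by_cases hZ : layer (blockOf (lev L k) M Z.1) = (i : ℕ)
  · rw [if_pos hZ]
    refine (block_poincare L M k f i Z (h0 Z)).trans ?_
    rw [Finset.mul_sum, Finset.mul_sum]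
    refine Finset.sum_le_sum fun μ _ => ?_
    rw [Finset.mul_sum, Finset.mul_sum, Finset.sum_filter]
    refine Finset.sum_le_sum fun o _ => ?_
    by_cases ho : (o μ : ℕ) + 1 < R
    · rw [if_pos ho, if_pos (rowMin_chartA L M k m layer i Z hZ o μ ho), norm_sq_meanS_shift_sub, ← mul_assoc, hfac]
    · rw [if_neg ho]
      split_ifs <;> positivity
  · rw [if_neg hZ]
    exact mul_nonneg (by norm_num) (Finset.sum_nonneg fun μ _ => Finset.sum_nonneg fun o _ => by split_ifs <;> positivity)

/-! ## §4 The correction -/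

/-- the layer-`i` rows of `Q′_GWn f` in squares: `nsq (rowLift (Q′_GWn f) i) = Σ_{layer-i anchors} s_i^d·|(Q′_{s_i}f)(z)|²`. [folklore] -/
theorem nsq_rowLift_QsGWn (f : TorK L M k → ℂ) (i : Fin (m + 1)) :
    nsq (rowLift L M k m layer (QsGWn L M k m layer *ᵥ f) i)
      = ∑ z : Anc (fine (lev L k) M) (sGW L k i),
          (if layer (blockOf (lev L k) M z.1) = (i : ℕ) then ((sGW L k i : ℕ) : ℝ) ^ d * ‖(meanS (fine (lev L k) M) (sGW L k i) *ᵥ f) z‖ ^ 2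
           else 0) := by
  unfold nsq
  refine Finset.sum_congr rfl fun z _ => ?_
  by_cases hz : layer (blockOf (lev L k) M z.1) = (i : ℕ)
  · rw [if_pos hz]
    have e : rowLift L M k m layer (QsGWn L M k m layer *ᵥ f) i z = (QsGWn L M k m layer *ᵥ f) ⟨⟨i, z⟩, hz⟩ := dif_pos hz
    rw [e, QsGWn_mulVec_apply, norm_mul, mul_pow, Complex.norm_real, Real.norm_of_nonneg (Real.sqrt_nonneg _),
      Real.sq_sqrt (pow_nonneg (Nat.cast_nonneg _) _)]
  · rw [if_neg hz]
    have e : rowLift L M k m layer (QsGWn L M k m layer *ᵥ f) i z = 0 := dif_neg hz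
    rw [e, norm_zero]
    simp

omit hM in
/-- `β₁(s)^{−2d} ≤ 36^d`. [folklore] -/
theorem inv_beta_sq_le (i : ℕ) : (((beta1 (sGW L k i)) ^ d)⁻¹) ^ 2 ≤ (36 : ℝ) ^ d := by
  have hβ := beta1_ge (n := sGW L k i)
  have h3 : ((beta1 (sGW L k i)) ^ d)⁻¹ ≤ (6 : ℝ) ^ d := by
    rw [← inv_pow]
    refine pow_le_pow_left₀ (inv_nonneg.mpr hβ.2.le) ?_ d
    rw [inv_le_comm₀ hβ.2 (by norm_num)]
    linarith [hβ.1]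
  calc (((beta1 (sGW L k i)) ^ d)⁻¹) ^ 2 ≤ ((6 : ℝ) ^ d) ^ 2 := pow_le_pow_left₀ (inv_nonneg.mpr (pow_nonneg hβ.2.le d)) h3 2
    _ = (36 : ℝ) ^ d := by rw [← pow_mul, mul_comm, pow_mul]; norm_num

omit hM in
/-- `(n/s_i)² ≤ L^{2i} = w_i²/s_i^d`. [folklore] -/
theorem div_sq_le_wsq (i : ℕ) : (((lev L k : ℕ) : ℝ) / ((sGW L k i : ℕ) : ℝ)) ^ 2 * ((sGW L k i : ℕ) : ℝ) ^ d ≤ wGW L k d i ^ 2 := by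
  have hs : (0 : ℝ) < ((sGW L k i : ℕ) : ℝ) := by exact_mod_cast s_pos (sGW L k i)
  have h1 : ((lev L k : ℕ) : ℝ) / ((sGW L k i : ℕ) : ℝ) ≤ (L : ℝ) ^ i := by
    rw [div_le_iff₀ hs, mul_comm]
    exact lev_le_sGW_mul_pow L k i
  rw [wGW_sq]
  refine mul_le_mul_of_nonneg_right ?_ (pow_nonneg hs.le d)
  calc (((lev L k : ℕ) : ℝ) / ((sGW L k i : ℕ) : ℝ)) ^ 2 ≤ ((L : ℝ) ^ i) ^ 2 := pow_le_pow_left₀ (by positivity) h1 2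
    _ = (L : ℝ) ^ (2 * i) := by rw [← pow_mul, mul_comm]

/-- the constant of the correction: `C_E = 2d(m+1)·36^d`. [folklore] -/
def CE (d m : ℕ) : ℝ := 2 * d * (m + 1) * (36 : ℝ) ^ d

/-- **THE GRADED MEAN CORRECTION**: every scalar `f` with zero UNIT-block means has a correction `ρ` with the same graded means,
`Q′_GWn ρ = Q′_GWn f`, and `‖∂ρ‖² ≤ 2d(m+1)·36^d·‖Q_GW(∂f)‖²` — LEVEL-FREE; hence `f − ρ ∈ N(Q′_GW)`.
[cite: Balaban1984PropagatorsII, (2.7) p.225 (shape: N(Q′) of the layered regions)] [folklore] -/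
theorem exists_meanCorrection (f : TorK L M k → ℂ)
    (h0 : ∀ Z : Anc (fine (lev L k) M) (lev L k), (meanS (fine (lev L k) M) (lev L k) *ᵥ f) Z = 0) :
    ∃ ρ : TorK L M k → ℂ, QsGWn L M k m layer *ᵥ ρ = QsGWn L M k m layer *ᵥ f ∧
      nsq (gradT L M k *ᵥ ρ) ≤ CE d m * nsq (QvGW L M k m layer *ᵥ (gradT L M k *ᵥ f)) := by
  set φ := QsGWn L M k m layer *ᵥ f with hφ
  refine ⟨plantGW L M k m layer (unplant L M k m layer φ), QsGWn_plantGW_unplant L M k m layer φ, ?_⟩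
  refine (nsq_gradT_plantGW_le L M k m layer _).trans ?_
  -- rewrite the per-row sum as a layered sum of the squares of the means
  have e1 : ∀ p : RowS L M k m layer,
      ((lev L k : ℕ) : ℝ) ^ 2 * (((sGW L k p.1.1 : ℕ) : ℝ) ^ d / ((sGW L k p.1.1 : ℕ) : ℝ) ^ 2) * ‖unplant L M k m layer φ p‖ ^ 2
        = (((lev L k : ℕ) : ℝ) / ((sGW L k p.1.1 : ℕ) : ℝ)) ^ 2 * (((beta1 (sGW L k p.1.1)) ^ d)⁻¹) ^ 2 * ‖φ p‖ ^ 2 := by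
    intro p
    simp only [unplant]
    rw [norm_mul, mul_pow, Complex.norm_real, Real.norm_eq_abs, sq_abs, ← mul_assoc, energy_coeff_unplant]
  rw [Finset.sum_congr rfl fun p _ => e1 p,
    ← sum_mul_nsq_rowLift L M k m layer φ (fun i => (((lev L k : ℕ) : ℝ) / ((sGW L k i : ℕ) : ℝ)) ^ 2 * (((beta1 (sGW L k i)) ^ d)⁻¹) ^ 2)]
  simp_rw [hφ, nsq_rowLift_QsGWn]
  -- per layer
  rw [nsq_QvGW_eq_sum, CE, Finset.mul_sum, Finset.mul_sum]
  refine Finset.sum_le_sum fun i _ => ?_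
  have hkey := layer_means_sq_le L M k m layer f h0 i
  have hβ := inv_beta_sq_le L k (d := d) i
  have hw := div_sq_le_wsq L k (d := d) i
  have hs : (0 : ℝ) ≤ ((sGW L k i : ℕ) : ℝ) ^ d := pow_nonneg (Nat.cast_nonneg _) d
  set D := (((lev L k : ℕ) : ℝ) / ((sGW L k i : ℕ) : ℝ)) ^ 2 with hD
  set B := (((beta1 (sGW L k i)) ^ d)⁻¹) ^ 2 with hB
  set S := ∑ z : Anc (fine (lev L k) M) (sGW L k i),
      (if layer (blockOf (lev L k) M z.1) = (i : ℕ) then ‖(meanS (fine (lev L k) M) (sGW L k i) *ᵥ f) z‖ ^ 2 else 0) with hS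
  set T := ∑ zν : Anc (fine (lev L k) M) (sGW L k i) × Fin d,
      (if rowMin L M k m layer i zν.1 zν.2 = (i : ℕ) then ‖(avgS (fine (lev L k) M) (sGW L k i) *ᵥ (gradT L M k *ᵥ f)) zν‖ ^ 2 else 0) with hT
  have hD0 : 0 ≤ D := sq_nonneg _
  have hB0 : 0 ≤ B := sq_nonneg _
  have hS0 : 0 ≤ S := Finset.sum_nonneg fun z _ => by split_ifs <;> positivity
  have hT0 : 0 ≤ T := Finset.sum_nonneg fun z _ => by split_ifs <;> positivity
  -- LHS_i = D·B·s^d·S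
  have lhs_eq : D * B * ∑ z : Anc (fine (lev L k) M) (sGW L k i),
      (if layer (blockOf (lev L k) M z.1) = (i : ℕ) then ((sGW L k i : ℕ) : ℝ) ^ d * ‖(meanS (fine (lev L k) M) (sGW L k i) *ᵥ f) z‖ ^ 2 else 0)
      = D * B * ((sGW L k i : ℕ) : ℝ) ^ d * S := by
    have e : ∑ z : Anc (fine (lev L k) M) (sGW L k i),
        (if layer (blockOf (lev L k) M z.1) = (i : ℕ) then ((sGW L k i : ℕ) : ℝ) ^ d * ‖(meanS (fine (lev L k) M) (sGW L k i) *ᵥ f) z‖ ^ 2 else 0)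
        = ((sGW L k i : ℕ) : ℝ) ^ d * S := by
      rw [hS, Finset.mul_sum]
      refine Finset.sum_congr rfl fun z _ => ?_
      split_ifs <;> simp
    rw [e]; ring
  -- RHS_i = 2d(m+1)36^d · Σ [row] w²·|avg|² = … · w² · T
  have rhs_eq : ∑ zν : Anc (fine (lev L k) M) (sGW L k i) × Fin d,
      (if rowMin L M k m layer i zν.1 zν.2 = (i : ℕ) then wGW L k d i ^ 2 * ‖(avgS (fine (lev L k) M) (sGW L k i) *ᵥ (gradT L M k *ᵥ f)) zν‖ ^ 2 else 0)
      = wGW L k d i ^ 2 * T := by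
    rw [hT, Finset.mul_sum]
    refine Finset.sum_congr rfl fun z _ => ?_
    split_ifs <;> simp
  rw [lhs_eq, rhs_eq]
  calc 4 * (d : ℝ) * (m + 1) * (D * B * ((sGW L k i : ℕ) : ℝ) ^ d * S)
      ≤ 4 * (d : ℝ) * (m + 1) * (wGW L k d i ^ 2 * (36 : ℝ) ^ d * (1 / 2 * T)) := by
        refine mul_le_mul_of_nonneg_left ?_ (by positivity)
        calc D * B * ((sGW L k i : ℕ) : ℝ) ^ d * S = (D * ((sGW L k i : ℕ) : ℝ) ^ d) * B * S := by ring
          _ ≤ wGW L k d i ^ 2 * (36 : ℝ) ^ d * (1 / 2 * T) := by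
            refine mul_le_mul (mul_le_mul hw hβ hB0 (sq_nonneg _)) hkey hS0 (by positivity)
    _ = 2 * (d : ℝ) * (m + 1) * (36 : ℝ) ^ d * (wGW L k d i ^ 2 * T) := by ring

end Summit.QuantumFields.BalabanUV.T4Continuum.GradedWellMeanCorrection

end
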